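import Literature.Geometry.Symplectic.ComplexHomologicalOrientation
import Literature.Geometry.Symplectic.CanonicalClass
import HarnessLib

/-!
# Hirzebruch's `c₁² = 2χ + 3σ` for closed almost complex `4`-manifolds (named fact)

Topic `Literature/Geometry/Symplectic`.  ONE named fact, no proofs.

For a closed connected smooth `4`-manifold `N` with a `C^∞` almost complex structure `J` and the
homological `ℤ`-orientation `μ` INDUCED by `J` (`μ.IsComplexOrientationOf J`,
`ComplexHomologicalOrientation.lean`), Hirzebruch's signature theorem combined with
`⟨c₂(TN, J), [N]⟩ = χ(N)` gives `⟨c₁(TN, J) ⌣ c₁(TN, J), [N]_μ⟩ = 2 χ(N) + 3 σ(N, μ)`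
(McDuff–Salamon 2017, Rem. 4.1.10, eq. (4.1.7): "Let `M` be a closed oriented smooth four-manifold,
let `J` be an almost complex structure on `M` [compatible with the orientation] … then
`c² = 2χ + 3σ`"; Hirzebruch signature theorem; Milnor–Stasheff, Cor. 11.12 for the top Chern class).

The statement below is, character for character, hypothesis `hB` of
`taubes_canonicalClass_symplecticCurve_four_of_hirzebruchPrinted_of_taubes_upToSign`
(`TaubesCanonicalClassSymplecticCurveFourProofs.lean`) AND hypothesis `hHW` of
`canonicalClass_sq_of_hirzebruchWu` (`CanonicalClassSqAndAdjunctionReduction.lean`): a statement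
SHARED by the two fact lineages `taubes_canonicalClass_symplecticCurve_four` and
`canonicalClass_sq_and_adjunction_of_symplectic_four`, vendored once here (promote event 3140251,
librarian triage case (c), 2026-08-16) in a light file importing only the vocabulary
(`AlmostComplexStructure.firstChernClass`, `HomologicalOrientation.IsComplexOrientationOf`,
`cupPairing`, `relEuler`, `HomologicalOrientation.signature`).  Deliberately NOT here: the
signature theorem itself (`⅓ ⟨p₁, [N]⟩ = σ`) as a separate statement, Chern–Weil, any proof.

## References

* D. McDuff, D. Salamon, *Introduction to Symplectic Topology*, 3rd ed., OUP (2017), Rem. 4.1.10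
  eq. (4.1.7), Rem. 4.1.12, Ex. 4.4.3 (v). [McDuffSalamon2017]
* F. Hirzebruch, *Topological Methods in Algebraic Geometry*, 3rd ed., Springer (1966), Thm. 8.2.2.
  [Hirzebruch1966]
* J. Milnor, J. Stasheff, *Characteristic Classes*, Ann. of Math. Stud. 76 (1974), Cor. 11.12,
  §19. [MilnorStasheff1974]
-/

noncomputable section

namespace Literature.Geometry.Symplectic

open scoped _root_.Manifold ContDiff
open Literature.AlgebraicTopology.SingularHomology

/-- **Hirzebruch–Wu: `⟨c₁ ⌣ c₁, [N]⟩ = 2χ + 3σ` for a closed connected almost complex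
`4`-manifold with the orientation induced by `J`.**  McDuff–Salamon 2017, Rem. 4.1.10 eq. (4.1.7)
(from Hirzebruch's signature theorem `σ = ⅓⟨c₁² − 2c₂, [N]⟩`, Ex. 4.4.3 (v) eq. (4.4.3), and
`⟨c₂, [N]⟩ = χ`, Milnor–Stasheff Cor. 11.12).  Verbatim hypothesis `hB` of
`taubes_canonicalClass_symplecticCurve_four_of_hirzebruchPrinted_of_taubes_upToSign` and `hHW` of
`canonicalClass_sq_of_hirzebruchWu`.
[cite: McDuffSalamon2017, Rem. 4.1.10 eq. (4.1.7); Ex. 4.4.3 (v) eq. (4.4.3)] -/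
def hirzebruch_firstChernClass_sq_eq_almostComplex_four : Prop :=
  ∀ (N : Type) [TopologicalSpace N] [T2Space N] [SecondCountableTopology N]
    [CompactSpace N] [ConnectedSpace N] [ChartedSpace (EuclideanSpace ℝ (Fin 4)) N]
    [IsManifold (𝓡 4) ∞ N] (J : AlmostComplexStructure (𝓡 4) ∞ N)
    (μ : HomologicalOrientation ℤ N 4), μ.IsComplexOrientationOf J →
    cupPairing μ two_add_two_eq_four J.firstChernClass J.firstChernClass =
      2 * relEuler ℤ ℤ N ∅ + 3 * μ.signature

end Literature.Geometry.Symplectic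

end
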